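/-
Copyright (c) 2026 the pub-hodgecm-mathlib formalisation cell (harness21).  Prover seat hodgecm-mathlib-K2E4-p10 (g7), Track B ∕ K2-LIT, h413 = `stmt-HodgeConjecture-24833`,
line `K2_E1_TraceFormulaBeta`, 5Res ROADCARD «ENDGAME BY FAMILIES» §3′ M2 v2 (K2E1-plan (g7), (204)∕(207)∕(232)) file D4′c (SD) part 3: the OPERATOR twin of ★ T2 ∕ ★ P2 §1–§2 —
unitarity and adjoint-reflection symmetry of an operator-valued axis datum from its functional equation and adjoint symmetry (the letters `hs1`∕`hss` of ★ HEAD-op).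
-/
import Summits.HodgeConjecture.HodgeConjecture.Theorems.K2E1PseudoEisensteinPlancherelRadialCMTwo   -- ★ P2 p859946 (K2E1-p13): `eventually_axis_notMem`, `tendsto_axis_nhdsNE`; brings ★ A `conj_vertical`
import Mathlib.Analysis.InnerProductSpace.Basic
import HarnessLib

/-!
# D4′c (SD) part 3 — `K2E1OperatorUnitaryAxisOfFE`: an operator datum `M(z) ∈ End V` with the functional equation `M(1−z)M(z) = 1` and the adjoint symmetry `M(z̄) = M(z)†` off a
# co-discrete exceptional set is UNITARY and ADJOINT-REFLECTION-SYMMETRIC at EVERY point of the unitary axis `z = ½ + it` (the letters `hs1`, `hss` of ★ HEAD-op)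

Track B ∕ K2-LIT, crux h413 = `stmt-HodgeConjecture-24833`, route of record `HCCMUnconditional`; cell `hodgecm-mathlib`, squad K2, ENGINE E1.  THEOREMS ONLY (no `def`, no `instance`,
no `notation`, no named-fact hypothesis, no `sorry`; default heartbeats); lane `--supports stmt-HodgeConjecture-24833 --as helper` (count-neutral).  No automorphic object (★ P2 is
imported only for its §1 axis-path lemmas).
THE MATHEMATICS ([MoeglinWaldspurger1995, IV.1.10, IV.3.12]; [Langlands1976, §7]; [Iwaniec2002, §6.3]).  The intertwining operator `M(z) = M(z; χ) ∈ End V(χ, K′, ω)` of a self-dual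
family satisfies the FUNCTIONAL EQUATION `M(1 − z)·M(z) = 1` (C3, K2E1-p13, matrix form of ★ T2′ F2) and the ADJOINT SYMMETRY `⟪x, M(z)y⟫ = ⟪M(z̄)x, y⟫` for the `L²(K_U)`-pairing of sections
(`M(z̄) = M(z)†`: the kernel is real ∕ Galois-conjugation invariant — the hconj payer), both off a closed co-discrete exceptional set `P` (poles of either side).  ON THE UNITARY AXIS
`z = ½ + it` one has `1 − z = z̄ = ½ − it`, so at the GENERIC axis points (`z, 1 − z, z̄ ∉ P` — all but countably many `t`, and eventually along `𝓝[≠] t₀` for every `t₀`, ★ P2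
`eventually_axis_notMem`) `⟪M(z)x, M(z)y⟫ = ⟪M(z̄)M(z)x, y⟫ = ⟪M(1−z)M(z)x, y⟫ = ⟪x, y⟫` (UNITARITY) and `⟪x, M(½+it)y⟫ = ⟪M(½−it)x, y⟫` (ADJOINT REFLECTION); if `t ↦ M(½+it)v` is
continuous for every `v` (no pole ON the axis — ★ (136)∕C3's axis regularity), both identities extend to EVERY `t` by uniqueness of limits along the punctured filter (§2).  These are
EXACTLY the hypotheses `hs1`, `hss` of ★ `K2E1PseudoEisensteinPlancherelIsometryOperator.plancherelForm_of_innerProductFormula_op` ∕ `hc1`, `hcs` of ★ `exists_linearIsometry_of_twoTerm_gram`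
(§3 prints them in those byte shapes).  The scalar case `dim V = 1` is ★ T2 `norm_eq_one_of_mul_one_sub_eq_one` + ★ P2 `norm_axis_eq_one`∕`axis_reflect`.  `M(z)` need not be linear here
(`M : ℂ → V → V`; consumers pass `fun z => ⇑(M z)`); `V` is any complex inner-product space.
* §1 `inner_map_map_eq_of_fe_of_adj` (generic point: FE + adjoint symmetry ⇒ `⟪M z x, M z y⟫ = ⟪x, y⟫` when `conj z = 1 − z`), `one_sub_axis_eq_conj` (`1 − (½+it) = conj (½+it)`).
* §2 `eq_of_eventually_nhdsNE_of_continuousAt` (two functions continuous at `t` and eventually equal on `𝓝[≠] t` agree at `t`), **`inner_map_map_axis_eq`** (unitarity at every axis point),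
  **`inner_map_axis_eq_inner_map_reflect`** (adjoint reflection at every axis point).
* §3 **`hs1_of_fe_of_adj`**, **`hss_of_fe_of_adj`** — the byte shapes of ★ HEAD-op's letters.
HONEST LABEL: HC_CM is proved only modulo the 7 printed citations (2 remaining named inputs: hLiu418 = `stmt-HodgeConjecture-24832`, h413 = `stmt-HodgeConjecture-24833`) until rung 0
closes; this file asserts no named fact, closes no socket; count-neutral; letters at instantiation: `hFE` (C3 matrix FE), `hadj` (hconj ∘ real kernel), `hcont` (axis regularity), `hPcd`.

## References
* [MoeglinWaldspurger1995] C. Mœglin, J.-L. Waldspurger, *Spectral decomposition and Eisenstein series* (1995), IV.1.10, IV.3.12.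
* [Langlands1976] R. P. Langlands, *On the Functional Equations Satisfied by Eisenstein Series*, LNM 544 (1976), §7.
* [Iwaniec2002] H. Iwaniec, *Spectral Methods of Automorphic Forms* (2nd ed., 2002), §6.3 (Thm 6.6).
-/

set_option autoImplicit false
set_option linter.dupNamespace false  -- the mandated namespace repeats the summit's segment (`HodgeConjecture.HodgeConjecture`)

noncomputable section

open Set Filter Topology Complex
open scoped Real ComplexConjugate InnerProductSpace
open Summit.HodgeConjecture.HodgeConjecture.Cruxes.H413.K2E1MellinPaleyWienerHalfLine (conj_vertical)
open Summit.HodgeConjecture.HodgeConjecture.Cruxes.H413.K2E1PseudoEisensteinPlancherelRadialCMTwo (eventually_axis_notMem)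

namespace Summit.HodgeConjecture.HodgeConjecture.Cruxes.H413.K2E1OperatorUnitaryAxisOfFE

variable {V : Type*} [NormedAddCommGroup V] [InnerProductSpace ℂ V]

/-! ## §1 The generic axis point: functional equation + adjoint symmetry ⇒ inner products preserved -/

/-- **FE + ADJOINT SYMMETRY ⇒ UNITARITY AT A POINT WITH `z̄ = 1 − z`**: if `M(1−z)(M(z)v) = v` for all `v` and `⟪x, M(z)y⟫ = ⟪M(z̄)x, y⟫` for all `x, y`, and `z̄ = 1 − z`, then
`⟪M(z)x, M(z)y⟫ = ⟪x, y⟫` (`= ⟪M(z̄)M(z)x, y⟫ = ⟪M(1−z)M(z)x, y⟫`).  Scalar twin: ★ T2 `norm_eq_one_of_mul_one_sub_eq_one`. [cite: Iwaniec2002, §6.3 (Thm 6.6)] [cite: MoeglinWaldspurger1995, IV.3.12] -/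
theorem inner_map_map_eq_of_fe_of_adj {M : ℂ → V → V} {z : ℂ} (hFE : ∀ v : V, M (1 - z) (M z v) = v) (hadj : ∀ x y : V, ⟪x, M z y⟫_ℂ = ⟪M (conj z) x, y⟫_ℂ)
    (hz : conj z = 1 - z) (x y : V) : ⟪M z x, M z y⟫_ℂ = ⟪x, y⟫_ℂ := by
  rw [hadj (M z x) y, hz, hFE x]

/-- On the unitary axis `1 − (½ + it) = conj (½ + it)` (`= ½ − it`). [folklore] -/
theorem one_sub_axis_eq_conj (t : ℝ) : 1 - ((((1 / 2 : ℝ)) : ℂ) + t * I) = conj ((((1 / 2 : ℝ)) : ℂ) + t * I) := by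
  rw [conj_vertical]
  apply Complex.ext
  · norm_num
  · simp

/-! ## §2 Extension across the exceptional axis points by continuity -/

/-- Two functions `ℝ → ℂ` continuous at `t` that agree eventually along the punctured filter `𝓝[≠] t` agree at `t` (limits along `𝓝[≠] t` are unique; `𝓝[≠] t` is non-trivial on `ℝ`).
[folklore] -/
theorem eq_of_eventually_nhdsNE_of_continuousAt {F G : ℝ → ℂ} {t : ℝ} (hF : ContinuousAt F t) (hG : ContinuousAt G t) (h : ∀ᶠ u in 𝓝[≠] t, F u = G u) : F t = G t :=
  tendsto_nhds_unique (hF.tendsto.mono_left nhdsWithin_le_nhds) ((hG.tendsto.mono_left nhdsWithin_le_nhds).congr' (h.mono fun _ hu => hu.symm))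

/-- **UNITARITY AT EVERY AXIS POINT**: `⟪M(½+it)x, M(½+it)y⟫ = ⟪x, y⟫` for ALL real `t`, from the functional equation `hFE` and the adjoint symmetry `hadj` off a co-discrete `P`
(`hPcd`) and the strong continuity `hcont` of `t ↦ M(½+it)v` — generically §1 (★ P2 `eventually_axis_notMem`: eventually along `𝓝[≠] t` the axis point avoids `P`, `1 − P`,
`conj P`), then §2 continuity. [cite: MoeglinWaldspurger1995, IV.3.12] [cite: Langlands1976, §7] -/
theorem inner_map_map_axis_eq {M : ℂ → V → V} {P : Set ℂ} (hPcd : ∀ z₀ : ℂ, ∀ᶠ s in 𝓝[≠] z₀, s ∉ P)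
    (hFE : ∀ z : ℂ, z ∉ P → 1 - z ∉ P → ∀ v : V, M (1 - z) (M z v) = v) (hadj : ∀ z : ℂ, z ∉ P → conj z ∉ P → ∀ x y : V, ⟪x, M z y⟫_ℂ = ⟪M (conj z) x, y⟫_ℂ)
    (hcont : ∀ v : V, Continuous fun t : ℝ => M ((((1 / 2 : ℝ)) : ℂ) + t * I) v) (t : ℝ) (x y : V) :
    ⟪M ((((1 / 2 : ℝ)) : ℂ) + t * I) x, M ((((1 / 2 : ℝ)) : ℂ) + t * I) y⟫_ℂ = ⟪x, y⟫_ℂ := by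
  refine eq_of_eventually_nhdsNE_of_continuousAt (F := fun u : ℝ => ⟪M ((((1 / 2 : ℝ)) : ℂ) + u * I) x, M ((((1 / 2 : ℝ)) : ℂ) + u * I) y⟫_ℂ) (G := fun _ => ⟪x, y⟫_ℂ)
    (((hcont x).continuousAt).inner ((hcont y).continuousAt)) continuousAt_const ?_
  filter_upwards [eventually_axis_notMem hPcd t] with u hu
  exact inner_map_map_eq_of_fe_of_adj (hFE _ hu.1 hu.2.1) (hadj _ hu.1 hu.2.2) (one_sub_axis_eq_conj u).symm x y

/-- **ADJOINT REFLECTION AT EVERY AXIS POINT**: `⟪x, M(½+it)y⟫ = ⟪M(½−it)x, y⟫` for ALL real `t` (`conj (½+it) = ½ + i(−t)`; generically `hadj`, then §2 continuity).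
[cite: MoeglinWaldspurger1995, IV.1.10] [cite: Langlands1976, §7] -/
theorem inner_map_axis_eq_inner_map_reflect {M : ℂ → V → V} {P : Set ℂ} (hPcd : ∀ z₀ : ℂ, ∀ᶠ s in 𝓝[≠] z₀, s ∉ P)
    (hadj : ∀ z : ℂ, z ∉ P → conj z ∉ P → ∀ x y : V, ⟪x, M z y⟫_ℂ = ⟪M (conj z) x, y⟫_ℂ)
    (hcont : ∀ v : V, Continuous fun t : ℝ => M ((((1 / 2 : ℝ)) : ℂ) + t * I) v) (t : ℝ) (x y : V) :
    ⟪x, M ((((1 / 2 : ℝ)) : ℂ) + t * I) y⟫_ℂ = ⟪M ((((1 / 2 : ℝ)) : ℂ) + ((-t : ℝ) : ℂ) * I) x, y⟫_ℂ := by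
  have h1 : ContinuousAt (fun u : ℝ => ⟪x, M ((((1 / 2 : ℝ)) : ℂ) + u * I) y⟫_ℂ) t := continuousAt_const.inner ((hcont y).continuousAt)
  have h2 : ContinuousAt (fun u : ℝ => ⟪M ((((1 / 2 : ℝ)) : ℂ) + ((-u : ℝ) : ℂ) * I) x, y⟫_ℂ) t :=
    (((hcont x).comp continuous_neg).continuousAt).inner continuousAt_const
  refine eq_of_eventually_nhdsNE_of_continuousAt h1 h2 ?_
  filter_upwards [eventually_axis_notMem hPcd t] with u hu
  rw [hadj _ hu.1 hu.2.2, conj_vertical]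

/-! ## §3 The byte shapes of ★ HEAD-op's letters `hs1`, `hss` (and `hc1`, `hcs` of ★ `exists_linearIsometry_of_twoTerm_gram`) -/

/-- **`hs1` OF ★ HEAD-op FROM (FE) + ADJOINT SYMMETRY + AXIS CONTINUITY**: `∀ t x y, ⟪s(½+it)x, s(½+it)y⟫ = ⟪x, y⟫` in exactly the binder shape of
★ `plancherelForm_of_innerProductFormula_op`. [cite: MoeglinWaldspurger1995, IV.3.12] -/
theorem hs1_of_fe_of_adj {s : ℂ → V → V} {P : Set ℂ} (hPcd : ∀ z₀ : ℂ, ∀ᶠ w in 𝓝[≠] z₀, w ∉ P)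
    (hFE : ∀ z : ℂ, z ∉ P → 1 - z ∉ P → ∀ v : V, s (1 - z) (s z v) = v) (hadj : ∀ z : ℂ, z ∉ P → conj z ∉ P → ∀ x y : V, ⟪x, s z y⟫_ℂ = ⟪s (conj z) x, y⟫_ℂ)
    (hcont : ∀ v : V, Continuous fun t : ℝ => s ((((1 / 2 : ℝ)) : ℂ) + t * I) v) :
    ∀ (t : ℝ) (x y : V), ⟪s ((((1 / 2 : ℝ)) : ℂ) + t * I) x, s ((((1 / 2 : ℝ)) : ℂ) + t * I) y⟫_ℂ = ⟪x, y⟫_ℂ :=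
  fun t x y => inner_map_map_axis_eq hPcd hFE hadj hcont t x y

/-- **`hss` OF ★ HEAD-op FROM ADJOINT SYMMETRY + AXIS CONTINUITY**: `∀ t x y, ⟪x, s(½+it)y⟫ = ⟪s(½+i(−t))x, y⟫` in exactly the binder shape of
★ `plancherelForm_of_innerProductFormula_op`. [cite: MoeglinWaldspurger1995, IV.1.10] -/
theorem hss_of_fe_of_adj {s : ℂ → V → V} {P : Set ℂ} (hPcd : ∀ z₀ : ℂ, ∀ᶠ w in 𝓝[≠] z₀, w ∉ P)
    (hadj : ∀ z : ℂ, z ∉ P → conj z ∉ P → ∀ x y : V, ⟪x, s z y⟫_ℂ = ⟪s (conj z) x, y⟫_ℂ)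
    (hcont : ∀ v : V, Continuous fun t : ℝ => s ((((1 / 2 : ℝ)) : ℂ) + t * I) v) :
    ∀ (t : ℝ) (x y : V), ⟪x, s ((((1 / 2 : ℝ)) : ℂ) + t * I) y⟫_ℂ = ⟪s ((((1 / 2 : ℝ)) : ℂ) + ((-t : ℝ) : ℂ) * I) x, y⟫_ℂ :=
  fun t x y => inner_map_axis_eq_inner_map_reflect hPcd hadj hcont t x y

/-- **`hc1`∕`hcs` OF ★ `exists_linearIsometry_of_twoTerm_gram`** (axis datum indexed by the real parameter, `c t := s(½+it)`): `⟪c t v, c t v′⟫ = ⟪v, v′⟫` and `⟪v, c t v′⟫ = ⟪c (−t) v, v′⟫`.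
[cite: MoeglinWaldspurger1995, IV.3.12] -/
theorem hc1_hcs_of_fe_of_adj {s : ℂ → V → V} {P : Set ℂ} (hPcd : ∀ z₀ : ℂ, ∀ᶠ w in 𝓝[≠] z₀, w ∉ P)
    (hFE : ∀ z : ℂ, z ∉ P → 1 - z ∉ P → ∀ v : V, s (1 - z) (s z v) = v) (hadj : ∀ z : ℂ, z ∉ P → conj z ∉ P → ∀ x y : V, ⟪x, s z y⟫_ℂ = ⟪s (conj z) x, y⟫_ℂ)
    (hcont : ∀ v : V, Continuous fun t : ℝ => s ((((1 / 2 : ℝ)) : ℂ) + t * I) v) :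
    (∀ (t : ℝ) (v v' : V), ⟪s ((((1 / 2 : ℝ)) : ℂ) + t * I) v, s ((((1 / 2 : ℝ)) : ℂ) + t * I) v'⟫_ℂ = ⟪v, v'⟫_ℂ) ∧
      ∀ (t : ℝ) (v v' : V), ⟪v, s ((((1 / 2 : ℝ)) : ℂ) + t * I) v'⟫_ℂ = ⟪s ((((1 / 2 : ℝ)) : ℂ) + ((-t : ℝ) : ℂ) * I) v, v'⟫_ℂ :=
  ⟨hs1_of_fe_of_adj hPcd hFE hadj hcont, hss_of_fe_of_adj hPcd hadj hcont⟩

end Summit.HodgeConjecture.HodgeConjecture.Cruxes.H413.K2E1OperatorUnitaryAxisOfFE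

end
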